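import Summits.Ventures.PercRepro.S1CoreCapSixCost

/-!
# PercRepro — TOWARDS `Q*(6) = 16`: ONE BIG LINE (p1, gen 25)

The case of exactly one line `A` of `≥ 4` points, the other lines `T` being 3-point lines (weights up to `5`). Over
`P₀ = A` the family `T` has the budget `freeCountR A l + fat (unionLR A l) + |A| ≤ 8` (`budget_one`); every line
of `T` meets `A` in `≤ 1` point, so the counting lemma applies: with `k = 8 − |A| − fat A` free lines at most,
`2 · #T ≤ k (k + 1)`. Fat points: through a new fat point `q ∉ A` pass `≤ 7 − |A| − fat A` lines
(`deg_new_fat_le`), the lines avoiding `q` have `≤ 6 − |A| − fat A` free lines (`free_avoid_le`), and through a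
fat point of `A` pass `≤ 8 − |A| − fat A` lines (`deg_fat_A_le`, a free sequence through a point of `P₀`). A line
with two new fat points (`fat (B ∖ A) = 2`) forces `A` simple with `|A| = 4` and every other line a chord
through one hub with a point on `B` (`≤ 3` of them); two new fat points on distinct lines force `A = (4,0)`, one
line through each and nothing else. The cap sum of `T` is `#T + Σ_v deg v` over the fat points
(`sum_cap_eq_card_add_sum_fat'`), and in every case `cap A + cap T ≤ 16` (`sum_cap_le_sixteen_of_one_big`).
`proofs/P1-S4-CAPBRIDGE.md` §17. Axioms: standard.
-/

namespace PercRepro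

namespace S1

namespace FourCap

variable {β : Type} [DecidableEq β]

omit [DecidableEq β] in
/-- The cap of a 3-point line with at most two fat points is `1 + fat`. -/
theorem capPaper_three_eq' {f : ℕ} (hf : f ≤ 2) : capPaper 3 f = 1 + f := by
  rcases (by omega : f = 0 ∨ f = 1 ∨ f = 2) with rfl | rfl | rfl <;> decide

omit [DecidableEq β] in
/-- **The cap sum of a family of 3-point lines** of weight `≤ 5` is `#T + Σ_L fat L`. -/
theorem sum_cap_eq_card_add_sum_fat' {w : β → ℕ} {T : Finset (Finset β)}
    (hT3 : ∀ L ∈ T, L.card = 3) (hTw : ∀ L ∈ T, ∀ v ∈ L, w v = 1 ∨ w v = 2) (hTw5 : ∀ L ∈ T, wsum w L ≤ 5) :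
    ∑ L ∈ T, capPaper L.card (fat w L) = T.card + ∑ L ∈ T, fat w L := by
  have hcap : ∀ L ∈ T, capPaper L.card (fat w L) = 1 + fat w L := by
    intro L hL
    have := wsum_eq_card_add_fat w L (hTw L hL)
    have := hTw5 L hL
    have := hT3 L hL
    rw [hT3 L hL]
    exact capPaper_three_eq' (by omega)
  rw [Finset.sum_congr rfl hcap, Finset.sum_add_distrib, ← Finset.card_eq_sum_ones]

section OneBig

variable {w : β → ℕ} {ls : Finset (Finset β)}
  (h1 : ∀ L ∈ ls, ∀ v ∈ L, w v = 1 ∨ w v = 2)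
  (h2 : ∀ L ∈ ls, 3 ≤ L.card ∧ wsum w L ≤ 5)
  (h3 : ∀ L ∈ ls, ∀ L' ∈ ls, L ≠ L' → (L ∩ L').card ≤ 1)
  (h4 : ∀ l : List (Finset β), l.Nodup → (∀ L ∈ l, L ∈ ls) → wsum w (unionL l) ≤ 6 + lineRank l)
  {A : Finset β} (hA : A ∈ ls) (cA : 4 ≤ A.card)
  (hrest : ∀ L ∈ ls, L ≠ A → L.card = 3)

include h1 h2 h4 hA hrest in
/-- **The budget over `A`**: `freeCountR A l + fat (unionLR A l) + |A| ≤ 8` for every list of other lines. -/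
theorem budget_one (l : List (Finset β)) (hnd : l.Nodup) (hl : ∀ L ∈ l, L ∈ ls ∧ L ≠ A) :
    freeCountR A l + fat w (unionLR A l) + A.card ≤ 8 := by
  have hnd' : (l ++ [A]).Nodup := by
    refine List.Nodup.append hnd (List.nodup_singleton A) ?_
    intro X hXl hX'
    rw [List.mem_singleton.1 hX'] at hXl
    exact (hl A hXl).2 rfl
  have hls : ∀ L ∈ l ++ [A], L ∈ ls := by
    intro L hL
    rcases List.mem_append.1 hL with h | h
    · exact (hl L h).1
    · rw [List.mem_singleton.1 h]; exact hA
  have h := budget_of_prefix h1 (fun L hL => le_trans (by omega) (h2 L hL).1) h4 [A] l hnd' hls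
    (fun L hL => hrest L (hl L hL).1 (hl L hL).2)
  simp only [costSum, unionL, Finset.union_empty, Nat.zero_add] at h
  rw [lineCost_empty] at h
  omega

include h1 h2 h4 hA hrest in
/-- The free count of a list of other lines is at most `8 − |A| − fat A`. -/
theorem free_le_one_big (l : List (Finset β)) (hnd : l.Nodup) (hl : ∀ L ∈ l, L ∈ ls ∧ L ≠ A) :
    freeCountR A l + A.card + fat w A ≤ 8 := by
  have h := budget_one h1 h2 h4 hA hrest l hnd hl
  have := fat_mono w (subset_unionLR A l)
  omega

include h1 h2 h3 h4 hA hrest in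
/-- **The counting bound**: `2 · #T ≤ k (k + 1)` for every `k ≥ 8 − |A| − fat A`. -/
theorem two_mul_card_le_one_big {k : ℕ} (hk : 8 ≤ k + A.card + fat w A) :
    2 * (ls.erase A).card ≤ k * (k + 1) :=
  two_mul_card_le_of_freeCountR A k (ls.erase A)
    (fun L hL => ⟨hrest L (Finset.mem_erase.1 hL).2 (Finset.mem_erase.1 hL).1,
      h3 L (Finset.mem_erase.1 hL).2 A hA (Finset.mem_erase.1 hL).1⟩)
    (fun L hL L' hL' hne => h3 L (Finset.mem_erase.1 hL).2 L' (Finset.mem_erase.1 hL').2 hne)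
    (fun l hnd hl => by
      have := free_le_one_big h1 h2 h4 hA hrest l hnd (fun L hL => ⟨(Finset.mem_erase.1 (hl L hL)).2,
        (Finset.mem_erase.1 (hl L hL)).1⟩)
      omega)

include h1 h2 h3 h4 hA hrest in
/-- **Through a point `v` pass at most `8 − |A| − fat A` other lines** (a free sequence over `A`, even for
`v ∈ A`), and one fewer for each further fat point of the union: `deg v + (fat of the union) + |A| ≤ 8`. -/
theorem deg_le_one_big (v : β) :
    ((ls.erase A).filter (fun L => v ∈ L)).card +
      fat w (unionLR A ((ls.erase A).filter (fun L => v ∈ L)).toList) + A.card ≤ 8 := by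
  set D := (ls.erase A).filter (fun L => v ∈ L) with hD
  have hmem : ∀ L ∈ D.toList, L ∈ ls ∧ L ≠ A ∧ v ∈ L := fun L hL => by
    have := Finset.mem_filter.1 (Finset.mem_toList.1 hL)
    exact ⟨(Finset.mem_erase.1 this.1).2, (Finset.mem_erase.1 this.1).1, this.2⟩
  have h := budget_one h1 h2 h4 hA hrest D.toList (Finset.nodup_toList D) (fun L hL => ⟨(hmem L hL).1, (hmem L hL).2.1⟩)
  rw [freeCountR_eq_length_of_mem' A D.toList (Finset.nodup_toList D)
    (fun L hL => ⟨hrest L (hmem L hL).1 (hmem L hL).2.1, (hmem L hL).2.2, h3 L (hmem L hL).1 A hA (hmem L hL).2.1⟩)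
    (fun L hL L' hL' hne => h3 L (hmem L hL).1 L' (hmem L' hL').1 hne), Finset.length_toList] at h
  exact h

include h1 h2 h3 h4 hA hrest in
/-- Through a fat point `q ∉ A` pass at most `7 − |A| − fat A` other lines. -/
theorem deg_new_fat_le {q : β} (hqA : q ∉ A) (hq2 : w q = 2) :
    ((ls.erase A).filter (fun L => q ∈ L)).card + A.card + fat w A + 1 ≤ 8 := by
  have h := deg_le_one_big h1 h2 h3 h4 hA hrest q
  set D := (ls.erase A).filter (fun L => q ∈ L) with hD
  rcases Finset.eq_empty_or_nonempty D with hempty | ⟨B, hB⟩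
  · rw [hempty]
    have := fat_mono w (subset_unionLR A ([] : List (Finset β)))
    simp only [Finset.card_empty, Nat.zero_add]
    have h2A := h2 A hA
    have := wsum_eq_card_add_fat w A (h1 A hA)
    omega
  · have hqU : q ∈ unionLR A D.toList := mem_unionLR_of_mem (Finset.mem_toList.2 hB) (Finset.mem_filter.1 hB).2
    have hfat : fat w A + 1 ≤ fat w (unionLR A D.toList) := by
      have hsub : A.filter (fun v => w v = 2) ∪ {q} ⊆ (unionLR A D.toList).filter (fun v => w v = 2) := by
        intro u hu
        rcases Finset.mem_union.1 hu with h | h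
        · exact Finset.mem_filter.2 ⟨subset_unionLR A _ (Finset.mem_filter.1 h).1, (Finset.mem_filter.1 h).2⟩
        · rw [Finset.mem_singleton.1 h]
          exact Finset.mem_filter.2 ⟨hqU, hq2⟩
      have hdisj : Disjoint (A.filter (fun v => w v = 2)) {q} := by
        rw [Finset.disjoint_singleton_right]
        exact fun h => hqA (Finset.mem_filter.1 h).1
      have := Finset.card_le_card hsub
      rw [Finset.card_union_of_disjoint hdisj, Finset.card_singleton] at this
      exact this
    omega

include h1 h2 h4 hA hrest in
/-- **The lines avoiding a fat point `q ∉ A`** (on a line `B`) have at most `6 − |A| − fat A` free lines: prepend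
`B`, which is free (`q` is new) and brings the fat point `q`. -/
theorem free_avoid_le {q : β} (hqA : q ∉ A) (hq2 : w q = 2) {B : Finset β} (hB : B ∈ ls) (hBA : B ≠ A)
    (hqB : q ∈ B) (l : List (Finset β)) (hnd : l.Nodup) (hl : ∀ L ∈ l, L ∈ ls ∧ L ≠ A ∧ q ∉ L) :
    freeCountR A l + A.card + fat w A + 2 ≤ 8 := by
  have hBl : B ∉ l := fun h => (hl B h).2.2 hqB
  have h := budget_one h1 h2 h4 hA hrest (B :: l) (List.nodup_cons.2 ⟨hBl, hnd⟩) (fun L hL => by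
    rcases List.mem_cons.1 hL with rfl | hL
    · exact ⟨hB, hBA⟩
    · exact ⟨(hl L hL).1, (hl L hL).2.1⟩)
  rw [freeCountR_cons_of_new hqB hqA (fun L hL => (hl L hL).2.2)] at h
  have hqU : q ∈ unionLR A (B :: l) := mem_unionLR_of_mem List.mem_cons_self hqB
  have hfat : fat w A + 1 ≤ fat w (unionLR A (B :: l)) := by
    have hsub : A.filter (fun v => w v = 2) ∪ {q} ⊆ (unionLR A (B :: l)).filter (fun v => w v = 2) := by
      intro u hu
      rcases Finset.mem_union.1 hu with h | h
      · exact Finset.mem_filter.2 ⟨subset_unionLR A _ (Finset.mem_filter.1 h).1, (Finset.mem_filter.1 h).2⟩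
      · rw [Finset.mem_singleton.1 h]
        exact Finset.mem_filter.2 ⟨hqU, hq2⟩
    have hdisj : Disjoint (A.filter (fun v => w v = 2)) {q} := by
      rw [Finset.disjoint_singleton_right]
      exact fun h => hqA (Finset.mem_filter.1 h).1
    have := Finset.card_le_card hsub
    rw [Finset.card_union_of_disjoint hdisj, Finset.card_singleton] at this
    exact this
  omega

end OneBig

end FourCap

end S1

end PercRepro
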